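import Summits.QuantumFields.BalabanUV.Beta.SaddleInverseModes
import Summits.QuantumFields.BalabanUV.Beta.SaddleInverseResidual

/-!
# Beta / SaddleInverseContract — THE ENGINE CONTRACT: `Beta/SaddleInverse` ∕ `Beta/SaddleInverseResidual` applied to the mode-diagonal block
# of `Beta/SaddleInverseModes` — `[[A,B♭],[B,0]] · pairingInv = 1 + 𝓔` with every structural object explicit, and `‖𝓔‖ ≤ ½ ⇒ ‖K⁻¹‖ ≤ 2‖pairingInv‖`
# (β sub-cell, CAP lane «KERNEL ALGEBRA + EXPORT», lineage `b2b-balaban-beta-cap3`, gen 10; corollaries only)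

WHY.  `Beta/SaddleInverseModes` (p207366) discharges the two structural hypotheses `A N = 0`, `A G = 1 − Y L` of the kernel-pairing
formula for every mode-diagonal alias block `A = Σ_t E_t N_t F_t` over a biorthogonal complete family.  This leaf records the resulting
BY-NAME statements an «A1-explicit» certificate engine (CAP-KERNEL §4.17, not commissioned) would have to feed: for ARBITRARY constraint
matrices `B♭`, `B` and ARBITRARY approximate Faddeev–Popov inverses `Vi`, `Wi` (floats at a box centre, or the Neumann-polynomial
preconditioners of `Beta/NeumannPoly`), the saddle matrix times the explicit `pairingInv` is `1 + 𝓔` with the explicit residual `𝓔` of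
`Beta/SaddleInverseResidual`; with exact inverses `pairingInv` IS the inverse; and over `ℂ` a residual bound `‖𝓔‖ ≤ ½` (Euclidean operator
norm) yields invertibility and `‖K⁻¹‖ ≤ 2 ‖pairingInv‖`.  The residual bound is an INPUT — nothing here certifies it.  [folklore]; three
one-line corollaries, nothing of the imported leaves re-proved.

## What is proved
* `saddle_aOp_mul_pairingInv_eq_one_add` — `saddle (aOp …) B♭ B * pairingInv B♭ B (gOp …) (kerFrame …) (cokerFrame …) Vi Wi = 1 + pairingResidual … (yFrame …) Vi Wi`.
* `inv_saddle_aOp_eq_pairingInv` — `B·kerFrame·Vi = 1`, `cokerFrame·B♭·Wi = 1` ⇒ `(saddle (aOp …) B♭ B)⁻¹ = pairingInv …`.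
* **`norm_inv_saddle_aOp_le`** (over `ℂ`, `Matrix.Norms.L2Operator`) — `‖pairingResidual …‖ ≤ 1/2 ⇒ IsUnit (saddle …).det ∧ ‖(saddle …)⁻¹‖ ≤ 2 * ‖pairingInv …‖`.

HONEST FRAMING.  Corollaries of landed leaves; no estimate is proved — the hypothesis `‖𝓔‖ ≤ ½` is assumed, not certified; NO bound on any object
of the cell, NO number of the β-function, NO statement about Bałaban's operators; discharges NOTHING of `FlowStep.BetaPertH`.  Discharging
`BetaPertH` would make Bałaban's ultraviolet stability unconditional — NOT the continuum limit and NOT the Clay problem.  0 `sorry`, 0 cite tags.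
-/

namespace Summit.QuantumFields.BalabanUV.Beta.SaddleInverseContract

open Matrix
open ModeSum (Biorth)
open SaddleInverse (saddle pairingInv pairingResidual)
open SaddleInverseModes (aOp gOp kerFrame cokerFrame yFrame aOp_mul_kerFrame aOp_mul_gOp)

section Ring

variable {ι n a m R : Type*} [Fintype ι] [Fintype n] [Fintype a] [Fintype m] [DecidableEq ι] [DecidableEq n] [DecidableEq a]
  [DecidableEq m] [CommRing R] {E : ι → Matrix n a R} {F : ι → Matrix a n R} {dd db : ι → a → R} {L c : ι → R}

/-- [folklore] `[[A, B♭], [B, 0]] · pairingInv(G, kerFrame, cokerFrame; Vi, Wi) = 1 + 𝓔(G, kerFrame, cokerFrame, Y; Vi, Wi)` for ARBITRARY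
`B♭`, `B`, `Vi`, `Wi` — `SaddleInverse.saddle_mul_pairingInv_eq_one_add` with its structural hypotheses discharged by `SaddleInverseModes`. -/
theorem saddle_aOp_mul_pairingInv_eq_one_add (hEF : Biorth E F) (hcpl : ∑ t, E t * F t = 1) (h : ∀ t, db t ⬝ᵥ dd t = L t)
    (hcL : ∀ t, c t * L t = 1) (Bf : Matrix n m R) (B : Matrix m n R) (Vi : Matrix ι m R) (Wi : Matrix m ι R) :
    saddle (aOp E F dd db L) Bf B * pairingInv Bf B (gOp E F dd db L c) (kerFrame E dd) (cokerFrame F db) Vi Wi =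
      1 + pairingResidual Bf B (gOp E F dd db L c) (kerFrame E dd) (cokerFrame F db) (yFrame E dd c) Vi Wi :=
  SaddleInverse.saddle_mul_pairingInv_eq_one_add (aOp_mul_kerFrame hEF h) (aOp_mul_gOp hEF hcpl h hcL) Vi Wi

/-- [folklore] With EXACT Faddeev–Popov inverses (`B·kerFrame·Vi = 1`, `cokerFrame·B♭·Wi = 1`) the kernel-pairing formula IS the inverse
(`SaddleInverse.inv_saddle_eq_pairingInv`, structural hypotheses discharged). -/
theorem inv_saddle_aOp_eq_pairingInv (hEF : Biorth E F) (hcpl : ∑ t, E t * F t = 1) (h : ∀ t, db t ⬝ᵥ dd t = L t)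
    (hcL : ∀ t, c t * L t = 1) {Bf : Matrix n m R} {B : Matrix m n R} {Vi : Matrix ι m R} {Wi : Matrix m ι R}
    (hV : B * kerFrame E dd * Vi = 1) (hW : cokerFrame F db * Bf * Wi = 1) :
    (saddle (aOp E F dd db L) Bf B)⁻¹ = pairingInv Bf B (gOp E F dd db L c) (kerFrame E dd) (cokerFrame F db) Vi Wi :=
  SaddleInverse.inv_saddle_eq_pairingInv (aOp_mul_kerFrame hEF h) (aOp_mul_gOp hEF hcpl h hcL) hV hW

end Ring

section Norm

open scoped Matrix.Norms.L2Operator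

variable {ι n a m : Type*} [Fintype ι] [Fintype n] [Fintype a] [Fintype m] [DecidableEq ι] [DecidableEq n] [DecidableEq a]
  [DecidableEq m] {E : ι → Matrix n a ℂ} {F : ι → Matrix a n ℂ} {dd db : ι → a → ℂ} {L c : ι → ℂ}

/-- [folklore] THE ENGINE CONTRACT (Euclidean operator norm): for the mode-diagonal block with EXPLICIT `G`, kernel ∕ cokernel frames and `Y`,
ANY constraint matrices `B♭`, `B` and ANY approximate Faddeev–Popov inverses `Vi`, `Wi`, a residual bound `‖𝓔‖ ≤ ½` gives invertibility of the
saddle matrix and `‖K⁻¹‖ ≤ 2 ‖pairingInv‖` (`SaddleInverse.norm_inv_le_of_mul_eq_one_add`).  The bound `‖𝓔‖ ≤ ½` is an INPUT. -/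
theorem norm_inv_saddle_aOp_le (hEF : Biorth E F) (hcpl : ∑ t, E t * F t = 1) (h : ∀ t, db t ⬝ᵥ dd t = L t)
    (hcL : ∀ t, c t * L t = 1) (Bf : Matrix n m ℂ) (B : Matrix m n ℂ) (Vi : Matrix ι m ℂ) (Wi : Matrix m ι ℂ)
    (hE : ‖pairingResidual Bf B (gOp E F dd db L c) (kerFrame E dd) (cokerFrame F db) (yFrame E dd c) Vi Wi‖ ≤ 1 / 2) :
    IsUnit (saddle (aOp E F dd db L) Bf B).det ∧
      ‖(saddle (aOp E F dd db L) Bf B)⁻¹‖ ≤ 2 * ‖pairingInv Bf B (gOp E F dd db L c) (kerFrame E dd) (cokerFrame F db) Vi Wi‖ :=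
  SaddleInverse.norm_inv_le_of_mul_eq_one_add (saddle_aOp_mul_pairingInv_eq_one_add hEF hcpl h hcL Bf B Vi Wi) hE

end Norm

end Summit.QuantumFields.BalabanUV.Beta.SaddleInverseContract
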